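import Mathlib
import Summits.NavierStokesRegularity.NavierStokesRegularity.Theorems.LerayQuarterDissipationFiniteDissipationLiouvilleLocalBalanceStretchingTools
import Summits.NavierStokesRegularity.NavierStokesRegularity.Theorems.DssFarFieldSlavingBlowupTypeIDssProfileSimilarityEnstrophyHardyThreshold
import HarnessLib

/-!
# Crux `FiniteDissipationLiouville` (stmt-NavierStokesRegularity-22144): THE LOCAL ENSTROPHY-BALANCE
# THRESHOLD IN STRETCHING FORM — `ω·Sω ≤ |∇ω|² + |ω|²/(4(−t))` everywhere forces triviality; a
# singular profile has a point where vortex stretching beats local dissipation-plus-scaling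

Theorems file of route `LerayQuarterDissipation` (lead prover g18; `--supports` the crux; sequel of
`…LocalBalance`). Navier–Stokes regularity is NOT proved by anything here; no summit is.

`…LocalBalance` uses the LAMB form `⟪U, Ω × curl Ω⟫` of the enstrophy production (from lead g17's
budget `…CrossFlowDss`). The two pointwise production densities `⟪Ω, ∇U Ω⟫ = ω·Sω` (stretching) and
`⟪U, Ω × curl Ω⟫` differ by a divergence, so a POINTWISE threshold in one form is not a pointwise
threshold in the other. This file runs the same scheme on the STRETCHING form, with pub-ns-dss's
original identity `½Z' = −∫|∇Ω|²_F − ¼Z + ∫⟪Ω, ∇U Ω⟫` (`…SimilarityEnstrophyIdentity.similarityEnstrophy_hasDerivAt`):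

* **`eq_zero_of_stretchingBalance`** — **every KNSS-gauge Type-I ancient mild field with a Type-I
  envelope such that `⟪ω, ∇u ω⟫ ≤ |∇ω|²_F + ‖ω‖²/(4(−t))` at every `t < 0`, `x` (vortex stretching
  never exceeds the local dissipation density plus the scale-invariant quarter of `‖ω‖²/(−t)`)
  VANISHES IDENTICALLY.** Rigidity: in the equality case `|∇Ω|²_F + ¼‖Ω‖² = ⟪Ω, ∇U Ω⟫ ≤ ‖∇U‖‖Ω‖²`, and
  the class-uniform gradient decay `‖∇U(s,y)‖ ≤ K₁(1+‖y‖)⁻²` (KNSS) makes `‖∇U‖ < ¼` outside a ball, so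
  the vorticity vanishes there, hence everywhere (analyticity). Compare the tree's stretching-RATE
  row (`ClockStretchingLaw`, `(−t)⟪Sξ,ξ⟫ ≤ θ < 1 ⇒ 0`, maximum principle): here ANY stretching rate is
  allowed where it is paid by local vorticity gradients, but only a quarter where it is not;
* `stretchingBalance_nsRescale`, `stretchingBalance_sim_of_phys`, `stretchingBalance_closed_of_tendsto`
  — scale invariance, similarity form, KNSS-closedness;
* **`exists_stretchingBalance_gap`**, **`stretching_excess_of_singular`** — the COLLAR `1 + ε(C)` and
  the PORTRAIT: the hypothetical singular profile has a space–time point with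
  `(1+ε)(|∇ω|²_F + ‖ω‖²/(4(−t))) < ⟪ω, ∇u ω⟫`;
* `exists_hardyStretching_gap`, `hardyStretching_excess_of_singular` — the COLLAR of the tree's closed
  Hardy-weighted stretching row T38 (`‖x‖²⟪∇u ω, ω⟫ ≤ ¼‖ω‖² ⇒ V ≡ 0`, sharp Hardy constant,
  pub-ns-dss `…SimilarityEnstrophy.typeI_ancient_hardyStretching_eq_zero`): on the enveloped class
  `‖x‖²⟪∇u ω, ω⟫ ≤ (¼ + ε(C))‖ω‖²` already forbids an apex singularity; portrait: somewhere
  `(¼ + ε)‖ω‖² < ‖x‖²⟪∇u ω, ω⟫`.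

HONEST FRAMING. The sharp pointwise form of the unweighted similarity-enstrophy method; silent when a
local stretching excess is compensated elsewhere (the generic case); `ε` ineffective. Necessary
conditions on a HYPOTHETICAL object; nothing is removed from the catalogued DSS wall beyond this
sub-class; verdict of the line unchanged (FRONTIER). Nothing here bears on Navier–Stokes regularity.

References: Koch–Nadirashvili–Seregin–Šverák, Acta Math. 203 (2009) §4, Prop. 4.1; Majda–Bertozzi
(2002) §1.2 (enstrophy production `ω·Sω`); Lemarié-Rieusset (2016) Thm 9.12.
-/

noncomputable section

set_option linter.dupNamespace false

namespace Summit.NavierStokesRegularity.NavierStokesRegularity.Theorems.FiniteDissipationLiouville.LocalBalance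

open MeasureTheory Set Filter Topology Metric InnerProductSpace Function Real
open scoped RealInnerProductSpace ContDiff
open Literature.Analysis Literature.Analysis.FluidPDE
open Summit.NavierStokesRegularity.NavierStokesRegularity.Theorems
open Summit.NavierStokesRegularity.NavierStokesRegularity.Theorems.GaussianGap
open Summit.NavierStokesRegularity.NavierStokesRegularity.Theorems.SimilarityEnstrophy
open Summit.NavierStokesRegularity.NavierStokesRegularity.Theorems.RecurrentReductionD
open Summit.NavierStokesRegularity.NavierStokesRegularity.Theorems.FiniteDissipationLiouville
open Summit.NavierStokesRegularity.NavierStokesRegularity.Theorems.FiniteDissipationLiouville.CrossFlow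
open Summit.NavierStokesRegularity.NavierStokesRegularity.Theorems.FiniteDissipationLiouville.EndpointScheme
open Summit.NavierStokesRegularity.NavierStokesRegularity.Theorems.FiniteDissipationLiouville.LambProduct

variable {C : ℝ} {V : ℝ → EuclideanSpace ℝ (Fin 3) → EuclideanSpace ℝ (Fin 3)}

/-! ### The threshold and its collar -/

section Threshold

/-- **THE LOCAL ENSTROPHY-BALANCE THRESHOLD, STRETCHING FORM (law-free).** A KNSS-gauge Type-I
ancient mild field `V` (`IsTypeIAncientMild C V`) with a Type-I envelope `HasTypeIDecay C V` such that
`⟪ω, ∇V ω⟫ ≤ |∇ω|²_F + ‖ω‖²/(4(−t))` at every `t < 0`, `x` (`ω = curl V(t)`: vortex stretching bounded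
by local dissipation plus the scale-invariant quarter of `‖ω‖²/(−t)`) vanishes identically on
`t < 0`. [folklore energy method + KNSS compactness] -/
theorem eq_zero_of_stretchingBalance (hV : IsTypeIAncientMild C V) (hdec : HasTypeIDecay C V)
    (hP : ∀ t < 0, ∀ x, ⟪curl (V t) x, fderiv ℝ (V t) x (curl (V t) x)⟫ ≤
      frobeniusNormSq (fderiv ℝ (curl (V t)) x) + ‖curl (V t) x‖ ^ 2 / (4 * (-t))) :
    ∀ t < 0, ∀ x, V t x = 0 := by
  -- the class-uniform gradient decay constant of the enveloped class
  obtain ⟨K₁, hK₁0, hK₁⟩ :=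
    IsTypeIAncientMild.exists_forall_pow_mul_norm_iteratedFDeriv_le_of_hasTypeIDecay 1 C
  have hP1 : ∀ t < 0, ∀ x, ⟪curl (V t) x, fderiv ℝ (V t) x (curl (V t) x)⟫ ≤
      1 * (frobeniusNormSq (fderiv ℝ (curl (V t)) x) + ‖curl (V t) x‖ ^ 2 / (4 * (-t))) :=
    fun t ht x => by rw [one_mul]; exact hP t ht x
  refine eq_zero_of_antitone_scheme (C := C)
    (P := fun F => ∀ t < 0, ∀ x, ⟪curl (F t) x, fderiv ℝ (F t) x (curl (F t) x)⟫ ≤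
      1 * (frobeniusNormSq (fderiv ℝ (curl (F t)) x) + ‖curl (F t) x‖ ^ 2 / (4 * (-t))))
    (fun F c hc hF => stretchingBalance_nsRescale hc hF)
    (fun u W hu _ hPu hW hunif _ hgr => stretchingBalance_closed_of_tendsto hu hW hunif hgr
      (θ := fun _ => 1) tendsto_const_nhds hPu)
    (fun F hF hdF hPF => ?_) (fun F hF hdF hPF hconst => ?_) hV hdec hP1
  · -- (iii) antitone enstrophy: `½Z' = −∫|∇Ω|² − ¼Z + Str ≤ 0`
    obtain ⟨C₁, C₂, C₃, hD1, hD2, hD3⟩ := IsTypeIAncientMild.gaugeBounds_of_hasTypeIDecay hF hdF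
    have hd := fun s => similarityEnstrophy_hasDerivAt hF hD1 hD2 hD3 s
    refine antitone_of_deriv_nonpos (fun s => (hd s).differentiableAt) fun s => ?_
    rw [(hd s).deriv]
    have iF := integrable_frobeniusNormSq_fderiv_lerayVorticity hF hD2 s
    have iZ := integrable_norm_lerayVorticity_sq hF hD1 s
    have iS := integrable_inner_stretching_lerayVorticity hF hD1 s
    have hS : ∫ y, ⟪lerayVorticity F s y, fderiv ℝ (lerayOrbit F s) y (lerayVorticity F s y)⟫ ≤
        (∫ y, frobeniusNormSq (fderiv ℝ (lerayVorticity F s) y)) +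
          (1 / 4) * ∫ y, ‖lerayVorticity F s y‖ ^ 2 := by
      have iZ' : Integrable fun y => (1 / 4 : ℝ) * ‖lerayVorticity F s y‖ ^ 2 := iZ.const_mul _
      have iFZ : Integrable fun y => frobeniusNormSq (fderiv ℝ (lerayVorticity F s) y) +
          (1 / 4 : ℝ) * ‖lerayVorticity F s y‖ ^ 2 := iF.add iZ'
      rw [← integral_const_mul, ← integral_add iF iZ']
      refine integral_mono iS iFZ fun y => ?_
      have h := stretchingBalance_sim_of_phys hPF s y
      rw [one_mul] at h
      exact h
    nlinarith
  · -- (iv) constant enstrophy: the balance density vanishes identically, slice by slice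
    obtain ⟨C₁, C₂, C₃, hD1, hD2, hD3⟩ := IsTypeIAncientMild.gaugeBounds_of_hasTypeIDecay hF hdF
    have hΩ0 : ∀ s y, lerayVorticity F s y = 0 := by
      intro s
      have hd := similarityEnstrophy_hasDerivAt hF hD1 hD2 hD3 s
      have hc : HasDerivAt (fun σ => ∫ y, ‖lerayVorticity F σ y‖ ^ 2) 0 s := by
        have : (fun σ => ∫ y, ‖lerayVorticity F σ y‖ ^ 2) =
            fun _ => ∫ y, ‖lerayVorticity F 0 y‖ ^ 2 := funext fun σ => hconst σ 0
        rw [this]; exact hasDerivAt_const _ _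
      have h0 := hd.unique hc
      have iF := integrable_frobeniusNormSq_fderiv_lerayVorticity hF hD2 s
      have iZ := integrable_norm_lerayVorticity_sq hF hD1 s
      have iS := integrable_inner_stretching_lerayVorticity hF hD1 s
      -- the balance density `e = |∇Ω|² + ¼‖Ω‖² − ⟪Ω, ∇U Ω⟫ ≥ 0` has integral `0`
      have iZ' : Integrable fun y => (1 / 4 : ℝ) * ‖lerayVorticity F s y‖ ^ 2 := iZ.const_mul _
      have iFZ : Integrable fun y => frobeniusNormSq (fderiv ℝ (lerayVorticity F s) y) +
          (1 / 4 : ℝ) * ‖lerayVorticity F s y‖ ^ 2 := iF.add iZ'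
      have iE : Integrable fun y => frobeniusNormSq (fderiv ℝ (lerayVorticity F s) y) +
          (1 / 4) * ‖lerayVorticity F s y‖ ^ 2 -
          ⟪lerayVorticity F s y, fderiv ℝ (lerayOrbit F s) y (lerayVorticity F s y)⟫ := iFZ.sub iS
      have hE0 : ∫ y, (frobeniusNormSq (fderiv ℝ (lerayVorticity F s) y) +
          (1 / 4) * ‖lerayVorticity F s y‖ ^ 2 -
          ⟪lerayVorticity F s y, fderiv ℝ (lerayOrbit F s) y (lerayVorticity F s y)⟫) = 0 := by
        rw [integral_sub iFZ iS, integral_add iF iZ', integral_const_mul]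
        linarith
      have hnn : ∀ y, 0 ≤ frobeniusNormSq (fderiv ℝ (lerayVorticity F s) y) +
          (1 / 4) * ‖lerayVorticity F s y‖ ^ 2 -
          ⟪lerayVorticity F s y, fderiv ℝ (lerayOrbit F s) y (lerayVorticity F s y)⟫ := fun y => by
        have h := stretchingBalance_sim_of_phys hPF s y
        rw [one_mul] at h
        linarith
      have hΩinf := contDiff_lerayVorticity_slice hF s
      have hUc := contDiff_lerayOrbit_slice_of_typeI hF s (n := 1) (by norm_cast)
      have hcont : Continuous fun y => frobeniusNormSq (fderiv ℝ (lerayVorticity F s) y) +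
          (1 / 4) * ‖lerayVorticity F s y‖ ^ 2 -
          ⟪lerayVorticity F s y, fderiv ℝ (lerayOrbit F s) y (lerayVorticity F s y)⟫ :=
        ((continuous_frobeniusNormSq'.comp (hΩinf.continuous_fderiv (by simp))).add
          (continuous_const.mul (hΩinf.continuous.norm.pow 2))).sub
          (hΩinf.continuous.inner ((hUc.continuous_fderiv (by simp)).clm_apply hΩinf.continuous))
      have hae := (integral_eq_zero_iff_of_nonneg hnn iE).1 hE0
      have hev := (hcont.ae_eq_iff_eq (μ := volume) continuous_const).1 hae
      -- far field: `‖∇U‖ < ¼` outside the ball of radius `2√K₁`, so `Ω = 0` there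
      refine lerayVorticity_eq_zero_of_eqOn_far hF s (R := 2 * Real.sqrt K₁) fun y hy => ?_
      have heq : frobeniusNormSq (fderiv ℝ (lerayVorticity F s) y) + (1 / 4) * ‖lerayVorticity F s y‖ ^ 2 ≤
          ⟪lerayVorticity F s y, fderiv ℝ (lerayOrbit F s) y (lerayVorticity F s y)⟫ := by
        have h1 : frobeniusNormSq (fderiv ℝ (lerayVorticity F s) y) + (1 / 4) * ‖lerayVorticity F s y‖ ^ 2 -
            ⟪lerayVorticity F s y, fderiv ℝ (lerayOrbit F s) y (lerayVorticity F s y)⟫ = 0 :=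
          congrFun hev y
        linarith
      refine eq_zero_of_stretchingBalance_le_of_opNorm_lt heq ?_
      have hDU := norm_fderiv_lerayOrbit_le_decay hF hD1 s y
      -- wait: `hD1` carries its own constant `C₁`; use instead the class-uniform `K₁`
      have hK := hK₁ hF hdF (-Real.exp (-s)) (neg_neg_of_pos (Real.exp_pos _)) (Real.exp (-s / 2) • y)
      rw [norm_iteratedFDeriv_one, neg_neg, sqrt_exp_neg, norm_smul,
        Real.norm_of_nonneg (Real.exp_pos _).le] at hK
      -- `‖DU(s,y)‖ = e^{-s}‖DV(t,x)‖ ≤ K₁ e^{-s}/(e^{-s/2}‖y‖ + e^{-s/2})² = K₁/(‖y‖+1)²`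
      have hpos : 0 < Real.exp (-s / 2) := Real.exp_pos _
      have hy0 : 0 ≤ ‖y‖ := norm_nonneg _
      have hden : 0 < (Real.exp (-s / 2) * ‖y‖ + Real.exp (-s / 2)) ^ (1 + 1) := by positivity
      have hDV : ‖fderiv ℝ (F (-Real.exp (-s))) (Real.exp (-s / 2) • y)‖ ≤
          K₁ / (Real.exp (-s / 2) * ‖y‖ + Real.exp (-s / 2)) ^ (1 + 1) := by
        rw [le_div_iff₀ hden, mul_comm]; exact hK
      rw [fderiv_lerayOrbit, norm_smul, Real.norm_of_nonneg (Real.exp_pos _).le]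
      have hee : Real.exp (-s / 2) * Real.exp (-s / 2) = Real.exp (-s) := by
        rw [← Real.exp_add]; congr 1; ring
      have e : K₁ / (Real.exp (-s / 2) * ‖y‖ + Real.exp (-s / 2)) ^ (1 + 1) =
          K₁ / (Real.exp (-s) * (‖y‖ + 1) ^ 2) := by
        congr 1
        rw [show Real.exp (-s / 2) * ‖y‖ + Real.exp (-s / 2) = Real.exp (-s / 2) * (‖y‖ + 1) by ring,
          mul_pow, ← hee]
        ring
      rw [e] at hDV
      have hy1 : 0 < (‖y‖ + 1) ^ 2 := by positivity
      calc Real.exp (-s) * ‖fderiv ℝ (F (-Real.exp (-s))) (Real.exp (-s / 2) • y)‖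
          ≤ Real.exp (-s) * (K₁ / (Real.exp (-s) * (‖y‖ + 1) ^ 2)) :=
            mul_le_mul_of_nonneg_left hDV (Real.exp_pos _).le
        _ = K₁ / (‖y‖ + 1) ^ 2 := by field_simp
        _ < 1 / 4 := by
            rw [div_lt_div_iff₀ hy1 (by norm_num : (0:ℝ) < 4)]
            have hsq : Real.sqrt K₁ ^ 2 = K₁ := Real.sq_sqrt hK₁0
            nlinarith [Real.sqrt_nonneg K₁]
    -- `F ≡ 0`
    have hcurl : ∀ t < 0, ∀ x, curl (F t) x = 0 := by
      intro t ht x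
      set s : ℝ := -Real.log (-t) with hs
      have hts : -Real.exp (-s) = t := by
        rw [hs, neg_neg, Real.exp_log (neg_pos.2 ht), neg_neg]
      have h := hΩ0 s ((Real.exp (-s / 2))⁻¹ • x)
      rw [lerayVorticity_apply, curl_lerayOrbit, smul_smul,
        mul_inv_cancel₀ (Real.exp_pos _).ne', one_smul, hts, smul_eq_zero] at h
      exact h.resolve_left (Real.exp_pos _).ne'
    have hconstF : ∀ t < 0, ∀ x, F t x = F t 0 := fun t ht x =>
      eq_of_curl_eq_zero_of_isDivFree_of_bounded ((hF.contDiff_slice ht).of_le (by norm_cast))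
        (hcurl t ht) (hF.isDivFree ht) (fun z => hF.norm_le ht z) x 0
    exact fun t ht x => hF.eq_zero_of_slice_const (b := fun t => F t 0) hconstF ht x

/-- **Regularity form.** [folklore] -/
theorem not_singular_of_stretchingBalance (hV : IsTypeIAncientMild C V) (hdec : HasTypeIDecay C V)
    (hP : ∀ t < 0, ∀ x, ⟪curl (V t) x, fderiv ℝ (V t) x (curl (V t) x)⟫ ≤
      frobeniusNormSq (fderiv ℝ (curl (V t)) x) + ‖curl (V t) x‖ ^ 2 / (4 * (-t))) :
    ¬ (∀ r > 0, ∀ M : ℝ, ∃ t ∈ Set.Ioo (-(r ^ 2)) (0 : ℝ),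
        ∃ x ∈ Metric.ball (0 : EuclideanSpace ℝ (Fin 3)) r, M < ‖V t x‖) := by
  intro hsing
  obtain ⟨t, ht, x, -, hM⟩ := hsing 1 one_pos 0
  rw [eq_zero_of_stretchingBalance hV hdec hP t ht.2 x, norm_zero] at hM
  exact lt_irrefl _ hM

/-- **THE COLLAR OF THE STRETCHING BALANCE.** For every `C` there is `ε = ε(C) > 0` such that no
KNSS-gauge Type-I field with `IsTypeIAncientMild C V`, `HasTypeIDecay C V` and
`⟪ω, ∇V ω⟫ ≤ (1 + ε)(|∇ω|²_F + ‖ω‖²/(4(−t)))` everywhere is singular at the apex.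
[cite: KochNadirashviliSereginSverak2009, §4 (arXiv:0709.3599 p. 8)] -/
theorem exists_stretchingBalance_gap (C : ℝ) : ∃ ε : ℝ, 0 < ε ∧
    ∀ V : ℝ → EuclideanSpace ℝ (Fin 3) → EuclideanSpace ℝ (Fin 3), IsTypeIAncientMild C V →
      HasTypeIDecay C V →
      (∀ t < 0, ∀ x, ⟪curl (V t) x, fderiv ℝ (V t) x (curl (V t) x)⟫ ≤
        (1 + ε) * (frobeniusNormSq (fderiv ℝ (curl (V t)) x) + ‖curl (V t) x‖ ^ 2 / (4 * (-t)))) →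
      ¬ (∀ r > 0, ∀ M : ℝ, ∃ t ∈ Ioo (-(r ^ 2)) (0 : ℝ),
        ∃ x ∈ ball (0 : EuclideanSpace ℝ (Fin 3)) r, M < ‖V t x‖) := by
  refine exists_gap_of_closed (C := C) (θ₀ := 1)
    (P := fun θ F => ∀ t < 0, ∀ x, ⟪curl (F t) x, fderiv ℝ (F t) x (curl (F t) x)⟫ ≤
      θ * (frobeniusNormSq (fderiv ℝ (curl (F t)) x) + ‖curl (F t) x‖ ^ 2 / (4 * (-t))))
    (fun u W θ θinf hu hPu hθ hW hunif _ hgr =>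
      stretchingBalance_closed_of_tendsto hu hW hunif hgr hθ hPu)
    (fun V hV hdec hP => not_singular_of_stretchingBalance hV hdec fun t ht x => ?_)
  have := hP t ht x
  rwa [one_mul] at this

/-- **PORTRAIT: vortex stretching beats local dissipation-plus-scaling somewhere, by a definite
factor.** For every `A` there is `ε = ε(A) > 0` such that every KNSS-gauge Type-I field with
`IsTypeIAncientMild C V`, `C ≤ A`, a Type-I envelope `HasTypeIDecay A V`, SINGULAR at the apex, has a
point `(t,x)`, `t < 0`, with `(1 + ε)(|∇ω|²_F + ‖ω‖²/(4(−t))) < ⟪ω, ∇V(t,x) ω⟩`, `ω = curl V(t,x)`.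
[folklore energy method + KNSS compactness] -/
theorem stretching_excess_of_singular (A : ℝ) : ∃ ε : ℝ, 0 < ε ∧
    ∀ (C : ℝ) (V : ℝ → EuclideanSpace ℝ (Fin 3) → EuclideanSpace ℝ (Fin 3)),
      IsTypeIAncientMild C V → C ≤ A → HasTypeIDecay A V →
      (∀ r > 0, ∀ M : ℝ, ∃ t ∈ Ioo (-(r ^ 2)) (0 : ℝ),
        ∃ x ∈ ball (0 : EuclideanSpace ℝ (Fin 3)) r, M < ‖V t x‖) →
      ∃ t : ℝ, t < 0 ∧ ∃ x : EuclideanSpace ℝ (Fin 3),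
        (1 + ε) * (frobeniusNormSq (fderiv ℝ (curl (V t)) x) + ‖curl (V t) x‖ ^ 2 / (4 * (-t))) <
          ⟪curl (V t) x, fderiv ℝ (V t) x (curl (V t) x)⟫ := by
  obtain ⟨ε, hε, h⟩ := exists_stretchingBalance_gap A
  refine ⟨ε, hε, fun C V hV hCA hdec hsing => ?_⟩
  by_contra hc
  push Not at hc
  exact h V (isTypeIAncientMild_of_le hV hCA) hdec hc hsing

/-! ### The collar of the Hardy-weighted stretching row -/

/-- **THE COLLAR OF THE HARDY STRETCHING ROW.** The tree's closed row T38
(`…SimilarityEnstrophy.typeI_ancient_hardyStretching_eq_zero`: `‖x − x₀‖²⟪∇V ω, ω⟫ ≤ ¼‖ω‖²`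
everywhere ⇒ `V ≡ 0`, given the gauge bounds (D), which the envelope supplies) is exceeded by a
definite amount on the enveloped class: for every `C` there is `ε > 0` such that
`‖x‖²⟪∇V(t,x) ω, ω⟫ ≤ (¼ + ε)‖ω‖²` everywhere (`ω = curl V(t,x)`, centre the apex) forbids an apex
singularity. [cite: KochNadirashviliSereginSverak2009, §4 (arXiv:0709.3599 p. 8)] -/
theorem exists_hardyStretching_gap (C : ℝ) : ∃ ε : ℝ, 0 < ε ∧
    ∀ V : ℝ → EuclideanSpace ℝ (Fin 3) → EuclideanSpace ℝ (Fin 3), IsTypeIAncientMild C V →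
      HasTypeIDecay C V →
      (∀ t < 0, ∀ x, ‖x‖ ^ 2 * ⟪fderiv ℝ (V t) x (curl (V t) x), curl (V t) x⟫ ≤
        (1 / 4 + ε) * ‖curl (V t) x‖ ^ 2) →
      ¬ (∀ r > 0, ∀ M : ℝ, ∃ t ∈ Ioo (-(r ^ 2)) (0 : ℝ),
        ∃ x ∈ ball (0 : EuclideanSpace ℝ (Fin 3)) r, M < ‖V t x‖) := by
  refine exists_gap_of_closed (C := C) (θ₀ := 1 / 4)
    (P := fun θ F => ∀ t < 0, ∀ x, ‖x‖ ^ 2 * ⟪fderiv ℝ (F t) x (curl (F t) x), curl (F t) x⟫ ≤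
      θ * ‖curl (F t) x‖ ^ 2)
    (fun u W θ θinf hu hPu hθ hW hunif _ hgr t ht x => ?_)
    (fun V hV hdec hP hsing => ?_)
  · -- closedness: first derivatives converge pointwise
    obtain ⟨b, hb⟩ : ∃ b : ℕ → EuclideanSpace ℝ (Fin 3), ∀ j, b j = curl (u j t) x := ⟨_, fun j => rfl⟩
    obtain ⟨L, hL⟩ : ∃ L : ℕ → (EuclideanSpace ℝ (Fin 3) →L[ℝ] EuclideanSpace ℝ (Fin 3)),
        ∀ j, L j = fderiv ℝ (u j t) x := ⟨_, fun j => rfl⟩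
    have htb : Tendsto b atTop (𝓝 (curl (W t) x)) :=
      (tendsto_curl_of_fderiv (hgr t ht x)).congr fun j => (hb j).symm
    have htL : Tendsto L atTop (𝓝 (fderiv ℝ (W t) x)) := (hgr t ht x).congr fun j => (hL j).symm
    have hLb : Tendsto (fun j => L j (b j)) atTop (𝓝 (fderiv ℝ (W t) x (curl (W t) x))) := by
      have h := ((ContinuousLinearMap.apply ℝ (EuclideanSpace ℝ (Fin 3)) (curl (W t) x)).continuous.tendsto
        (fderiv ℝ (W t) x)).comp htL
      have hdiff : Tendsto (fun j => L j (b j) - L j (curl (W t) x)) atTop (𝓝 0) := by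
        have hbd : ∀ j, ‖L j (b j) - L j (curl (W t) x)‖ ≤ ‖L j‖ * ‖b j - curl (W t) x‖ := by
          intro j
          rw [← map_sub]
          exact (L j).le_opNorm _
        have h1 : Tendsto (fun j => ‖L j‖ * ‖b j - curl (W t) x‖) atTop (𝓝 0) := by
          have := htL.norm.mul (tendsto_iff_norm_sub_tendsto_zero.1 htb)
          simpa using this
        exact squeeze_zero_norm hbd h1
      have hsum := h.add hdiff
      simp only [Function.comp, ContinuousLinearMap.apply_apply, add_zero] at hsum
      exact hsum.congr fun j => by abel
    have hLHS : Tendsto (fun j => ‖x‖ ^ 2 * ⟪L j (b j), b j⟫) atTop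
        (𝓝 (‖x‖ ^ 2 * ⟪fderiv ℝ (W t) x (curl (W t) x), curl (W t) x⟫)) := (hLb.inner htb).const_mul _
    have hRHS : Tendsto (fun j => θ j * ‖b j‖ ^ 2) atTop (𝓝 (θinf * ‖curl (W t) x‖ ^ 2)) :=
      hθ.mul (htb.norm.pow 2)
    exact le_of_tendsto_of_tendsto' hLHS hRHS fun j => by rw [hb, hL]; exact hPu j t ht x
  · -- kill at `θ₀ = ¼`: the tree's Hardy row, with (D) from the envelope
    obtain ⟨C₁, C₂, C₃, hD1, hD2, hD3⟩ := IsTypeIAncientMild.gaugeBounds_of_hasTypeIDecay hV hdec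
    have h0 := typeI_ancient_hardyStretching_eq_zero hV hD1 hD2 hD3 0 fun t ht x => by
      rw [sub_zero]; exact hP t ht x
    obtain ⟨t, ht, x, -, hM⟩ := hsing 1 one_pos 0
    rw [h0 t ht.2 x, norm_zero] at hM
    exact lt_irrefl _ hM

/-- **PORTRAIT: the Hardy-weighted stretching exceeds the sharp Hardy quarter by a definite amount
somewhere.** For every `A` there is `ε = ε(A) > 0` such that every singular KNSS-gauge Type-I field
with `IsTypeIAncientMild C V`, `C ≤ A`, `HasTypeIDecay A V` has a point with
`(¼ + ε)‖ω‖² < ‖x‖²⟪∇V(t,x) ω, ω⟫`. [folklore energy method + KNSS compactness] -/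
theorem hardyStretching_excess_of_singular (A : ℝ) : ∃ ε : ℝ, 0 < ε ∧
    ∀ (C : ℝ) (V : ℝ → EuclideanSpace ℝ (Fin 3) → EuclideanSpace ℝ (Fin 3)),
      IsTypeIAncientMild C V → C ≤ A → HasTypeIDecay A V →
      (∀ r > 0, ∀ M : ℝ, ∃ t ∈ Ioo (-(r ^ 2)) (0 : ℝ),
        ∃ x ∈ ball (0 : EuclideanSpace ℝ (Fin 3)) r, M < ‖V t x‖) →
      ∃ t : ℝ, t < 0 ∧ ∃ x : EuclideanSpace ℝ (Fin 3),
        (1 / 4 + ε) * ‖curl (V t) x‖ ^ 2 < ‖x‖ ^ 2 * ⟪fderiv ℝ (V t) x (curl (V t) x), curl (V t) x⟫ := by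
  obtain ⟨ε, hε, h⟩ := exists_hardyStretching_gap A
  refine ⟨ε, hε, fun C V hV hCA hdec hsing => ?_⟩
  by_contra hc
  push Not at hc
  exact h V (isTypeIAncientMild_of_le hV hCA) hdec hc hsing

end Threshold

end Summit.NavierStokesRegularity.NavierStokesRegularity.Theorems.FiniteDissipationLiouville.LocalBalance

end
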